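import Summits.Ventures.HSemireg.WeilFrameRealCarrierAllDegrees
import Summits.Ventures.HSemireg.WeilFrameLeadingTerm
import Summits.Ventures.HSemireg.WeilFrameLeadingTermUpper
import Summits.Ventures.HSemireg.WeilFrameLeadingTermMiddle
import Summits.Ventures.HSemireg.WeilFramePureMiddle
import Summits.Ventures.HSemireg.WeilFrameLeadingTermPins

/-!
# Venture HSemireg — THE EULER-PIN VALUE OF TABLE R's `ch(O_Z)`-SHAPE ROWS ON THE REAL CARRIER, EVERY `n ≥ 2`:
# `Σ_{k=0}^{2n} (−1)^k dim S_k(x) = (−1)ⁿ·(2C(2n−2,n−1) + 2n + 2 − δ)`, `δ` = the middle drop (`0` off the pins; `1` self-dual; `2` odd `n`; `1 ∕ 2` pure row)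

HONEST FRAMING. Part of the Lean index of the computation cell `pub-hsemireg` (seat w3-mod4-1 gen 14, W3 SPECIAL FIBRES;
MOD4-OFFSPLIT §10 (E24) THEOREM R_Z ∕ THEOREM A_{2n}: «e_n := R(−1) = (−1)ⁿ·2(C(2n−2,n−1) + n + 1) = 10, −20, 50, −152, 518, −1864 for
n = 2…7 — pencil», §13.22–13.28). This file only ADDS UP the lane's degree-wise kernel theorems for general `n`; the tree's real carriers
and the Literature's Weil-type layer ONLY: no semiregularity map, no Ext group, no `∫`, no HRR; nothing here says that HC / HC_CM / HC_AV
holds, or that any object is or is not semiregular; no Literature fact is declared; NO definition is introduced.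
Imports: FILES 15 (edge degrees, duality), 33 + 36 (side degrees), 35 (generic middle), 38 (pure row at the pins), 40 (self-dual pin, odd `n`).

WHAT IS PROVED.
(1) COMBINATORICS: `alternating_partial_sum_mul_choose` (`Σ_{k ≤ m+1} (−1)^k k C(N+2,k) = −(N+2)(−1)^m C(N,m)`), **`alternating_sum_leading_row`**
(the row identity above, every `n ≥ 2`, any drop `δ`).
(2) ON THE REAL CARRIER of a polarised Weil-type `2n`-fold (`n ≥ 2`; hypotheses of `finrank_S_weilType_middle`), for
`x = Σ_{m ≤ 2n} (q_m/m!) ĥ^m + ĉ₊ + ĉ₋` with `q_m = 0` (`m < n`), `q_n ≠ 0`, ANY tail, pin `(2n)!·(ĉ₊ĉ₋) = t·ĥ^{2n}`, `E(x) := Σ_{k=0}^{2n} (−1)^k dim S_k(x)`: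
* **`eulerSum_leading_generic`** — `t` off the pins `(−1)ⁿ C(n,a)² q_n²` ⇒ `E(x) = (−1)ⁿ (2C(2n−2,n−1) + 2n + 2)` (= `e_n`: `10, −20, 50, −152, 518, …`);
* **`eulerSum_leading_self_dual_pin`** — `2a = n`, `t = (−1)ⁿ C(n,a)² q_n²` ⇒ `E(x) = (−1)ⁿ (2C(2n−2,n−1) + 2n + 1)`;
* **`eulerSum_leading_pin_odd`** — `n` odd, `t = (−1)ⁿ C(n,a)² q_n²` ⇒ `E(x) = (−1)ⁿ (2C(2n−2,n−1) + 2n)` (e.g. `n = 3`: `−18`);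
* **`eulerSum_pureMiddle_pin`** — the PURE row (`q_m = 0` for `m ≠ n`) at `t = (−1)ⁿ C(n,a)² q_n²`:
  `E(x) = (−1)ⁿ (2C(2n−2,n−1) + 2n + 2 − (1 if 2a = n else 2))`.
So the Euler-pin side of THEOREM A_{2n} ∕ the odd-`n` windows is ONE kernel number for every `n ≥ 2` and every `ch(O_Z)`-shape up to the
even-`n` tail bit of §13.25–13.27 (decided there for `n = 2, 4`). Everything PROVED, 0 sorry.
References: [BuchweitzFlenner2008HH] Prop. 6.4.4; [vanGeemen1994HodgeAV] 4.9, Lemma 5.2; [BourbakiAlgebre1a3] Ch. III §8, §11 no. 9.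
-/

noncomputable section

open CliffordAlgebra (contractLeft)
open ExteriorAlgebra (ι)
open Module CategoryTheory
open Literature.AlgebraicGeometry.Motives Literature.AlgebraicGeometry.HodgeTheory
open Literature.AlgebraicTopology.SingularHomology

namespace Summit.Ventures.HSemireg.WeilFrame

open Summit.Ventures.HSemireg.WedgeBridge Summit.Ventures.HSemireg.WeilCarrier Summit.Ventures.HSemireg.Mod4Carrier
open Summit.Ventures.HSemireg.Wedge.Hankel

/-! ### 1. Combinatorics of the row -/

section Combinatorics

open Finset

/-- **partial alternating first moment:** `Σ_{k ≤ m+1} (−1)^k k C(N+2,k) = −(N+2)(−1)^m C(N,m)` (from `k C(N+2,k) = (N+2) C(N+1,k−1)` and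
Mathlib's `Int.alternating_sum_range_choose_eq_choose`). [cite: BourbakiAlgebre1a3, Ch. III §8] -/
theorem alternating_partial_sum_mul_choose (N m : ℕ) :
    ∑ k ∈ Finset.range (m + 2), (-1 : ℤ) ^ k * (k : ℤ) * ((N + 2).choose k : ℤ) =
      -((N + 2 : ℕ) : ℤ) * ((-1 : ℤ) ^ m * (N.choose m : ℤ)) := by
  -- shift: the `k = 0` term vanishes, and `k C(N+2,k) = (N+2) C(N+1,k-1)`
  rw [Finset.sum_range_succ', Nat.cast_zero, mul_zero, zero_mul, add_zero]
  have h : ∀ k ∈ Finset.range (m + 1), (-1 : ℤ) ^ (k + 1) * ((k + 1 : ℕ) : ℤ) * ((N + 2).choose (k + 1) : ℤ) =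
      -((N + 2 : ℕ) : ℤ) * ((-1 : ℤ) ^ k * ((N + 1).choose k : ℤ)) := by
    intro k _
    -- `(N+1+1) * choose (N+1) k = choose (N+1+1) (k+1) * (k+1)`
    have e' : ((N + 1 + 1 : ℕ) : ℤ) * (((N + 1).choose k : ℕ) : ℤ) = (((N + 1 + 1).choose (k + 1) : ℕ) : ℤ) * ((k + 1 : ℕ) : ℤ) := by
      exact_mod_cast Nat.add_one_mul_choose_eq (N + 1) k
    rw [pow_succ]
    push_cast at e' ⊢
    linear_combination (-1 : ℤ) ^ k * e'
  rw [Finset.sum_congr rfl h, ← Finset.mul_sum, Int.alternating_sum_range_choose_eq_choose]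

/-- **the row lemma, every `n ≥ 2`:** a row `R` with `R_k + 2(k+1)C(n,k) = (k+3)C(2n,k)` for `k ≤ n − 1` (lower half, edge
included), the same for `R_{2n−k}` (upper half), and `R_n + 2(n+1) + δ = (n+3)C(2n,n)` (middle, drop `δ`) has alternating sum
`Σ_{k ≤ 2n} (−1)^k R_k = (−1)ⁿ (2C(2n−2,n−1) + 2n + 2 − δ)` — split the range at `n`, reflect the upper block, evaluate the four partial
alternating sums in closed form, and finish with `(m+1)C(2m+2,m+1) = (m+2)C(2m+2,m)` (`n = m + 2`). [cite: BourbakiAlgebre1a3, Ch. III §8] -/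
theorem alternating_sum_leading_row {n : ℕ} (hn : 2 ≤ n) (R : ℕ → ℕ) (δ : ℕ)
    (hlow : ∀ k, k + 1 ≤ n → R k + 2 * (k + 1) * n.choose k = (k + 3) * (n + n).choose k)
    (hup : ∀ k, k + 1 ≤ n → R (n + n - k) + 2 * (k + 1) * n.choose k = (k + 3) * (n + n).choose k)
    (hmid : R n + 2 * (n + 1) + δ = (n + 3) * (n + n).choose n) :
    ∑ k ∈ Finset.range (n + n + 1), (-1 : ℤ) ^ k * (R k : ℤ) =
      (-1 : ℤ) ^ n * (2 * ((n + n - 2).choose (n - 1) : ℤ) + 2 * n + 2 - δ) := by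
  obtain ⟨m, rfl⟩ : ∃ m, n = m + 2 := ⟨n - 2, by omega⟩
  -- split the range: `[0, n) ∪ {n} ∪ (n, 2n]`, reflect the upper block onto `[0, n)`
  have hsplit : ∑ k ∈ Finset.range (m + 2 + (m + 2) + 1), (-1 : ℤ) ^ k * (R k : ℤ) =
      ∑ k ∈ Finset.range (m + 2), (-1 : ℤ) ^ k * (R k : ℤ) + (-1 : ℤ) ^ (m + 2) * (R (m + 2) : ℤ) +
        ∑ j ∈ Finset.range (m + 2), (-1 : ℤ) ^ (m + 2 + 1 + j) * (R (m + 2 + 1 + j) : ℤ) := by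
    rw [show m + 2 + (m + 2) + 1 = (m + 2 + 1) + (m + 2) by ring, Finset.sum_range_add, Finset.sum_range_succ]
  have hrefl : ∑ j ∈ Finset.range (m + 2), (-1 : ℤ) ^ (m + 2 + 1 + j) * (R (m + 2 + 1 + j) : ℤ) =
      ∑ j ∈ Finset.range (m + 2), (-1 : ℤ) ^ j * (R (m + 2 + (m + 2) - j) : ℤ) := by
    rw [← Finset.sum_range_reflect (fun j => (-1 : ℤ) ^ (m + 2 + 1 + j) * (R (m + 2 + 1 + j) : ℤ)) (m + 2)]
    refine Finset.sum_congr rfl fun j hj => ?_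
    rw [Finset.mem_range] at hj
    have e1 : m + 2 + 1 + (m + 2 - 1 - j) = m + 2 + (m + 2) - j := by omega
    have e2 : (-1 : ℤ) ^ (m + 2 + 1 + (m + 2 - 1 - j)) = (-1 : ℤ) ^ j := by
      rw [show m + 2 + 1 + (m + 2 - 1 - j) = j + 2 * (m + 2 - j) by omega, pow_add, pow_mul, neg_one_sq, one_pow, mul_one]
    rw [e2, e1]
  -- the two half-rows in closed form
  have hL : ∀ j ∈ Finset.range (m + 2), (-1 : ℤ) ^ j * (R j : ℤ) =
      (-1 : ℤ) ^ j * (j : ℤ) * ((m + 2 + (m + 2)).choose j : ℤ) + 3 * ((-1 : ℤ) ^ j * ((m + 2 + (m + 2)).choose j : ℤ))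
        - 2 * ((-1 : ℤ) ^ j * (j : ℤ) * ((m + 2).choose j : ℤ)) - 2 * ((-1 : ℤ) ^ j * ((m + 2).choose j : ℤ)) := by
    intro j hj
    rw [Finset.mem_range] at hj
    have h := hlow j (by omega)
    have h' : (R j : ℤ) = (j + 3) * ((m + 2 + (m + 2)).choose j : ℤ) - 2 * (j + 1) * ((m + 2).choose j : ℤ) := by
      have := congrArg (fun x : ℕ => (x : ℤ)) h
      push_cast at this
      linarith
    rw [h']
    ring
  have hU : ∀ j ∈ Finset.range (m + 2), (-1 : ℤ) ^ j * (R (m + 2 + (m + 2) - j) : ℤ) =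
      (-1 : ℤ) ^ j * (j : ℤ) * ((m + 2 + (m + 2)).choose j : ℤ) + 3 * ((-1 : ℤ) ^ j * ((m + 2 + (m + 2)).choose j : ℤ))
        - 2 * ((-1 : ℤ) ^ j * (j : ℤ) * ((m + 2).choose j : ℤ)) - 2 * ((-1 : ℤ) ^ j * ((m + 2).choose j : ℤ)) := by
    intro j hj
    rw [Finset.mem_range] at hj
    have h := hup j (by omega)
    have h' : (R (m + 2 + (m + 2) - j) : ℤ) =
        (j + 3) * ((m + 2 + (m + 2)).choose j : ℤ) - 2 * (j + 1) * ((m + 2).choose j : ℤ) := by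
      have := congrArg (fun x : ℕ => (x : ℤ)) h
      push_cast at this
      linarith
    rw [h']
    ring
  -- closed forms of the four partial alternating sums
  have hA : ∑ j ∈ Finset.range (m + 2), (-1 : ℤ) ^ j * ((m + 2 + (m + 2)).choose j : ℤ) =
      (-1 : ℤ) ^ (m + 1) * ((2 * m + 3).choose (m + 1) : ℤ) := by
    rw [show m + 2 + (m + 2) = (2 * m + 3) + 1 by ring]
    exact_mod_cast Int.alternating_sum_range_choose_eq_choose
  have hB : ∑ j ∈ Finset.range (m + 2), (-1 : ℤ) ^ j * (j : ℤ) * ((m + 2 + (m + 2)).choose j : ℤ) =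
      -((2 * m + 2 + 2 : ℕ) : ℤ) * ((-1 : ℤ) ^ m * ((2 * m + 2).choose m : ℤ)) := by
    rw [show m + 2 + (m + 2) = (2 * m + 2) + 2 by ring]
    exact alternating_partial_sum_mul_choose (2 * m + 2) m
  have hA' : ∑ j ∈ Finset.range (m + 2), (-1 : ℤ) ^ j * ((m + 2).choose j : ℤ) =
      (-1 : ℤ) ^ (m + 1) * ((m + 1).choose (m + 1) : ℤ) := by
    exact_mod_cast Int.alternating_sum_range_choose_eq_choose
  have hB' : ∑ j ∈ Finset.range (m + 2), (-1 : ℤ) ^ j * (j : ℤ) * ((m + 2).choose j : ℤ) =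
      -((m + 2 : ℕ) : ℤ) * ((-1 : ℤ) ^ m * (m.choose m : ℤ)) := alternating_partial_sum_mul_choose m m
  -- binomial bookkeeping: a = C(2m+2, m), b = C(2m+2, m+1)
  have pa1 : (2 * m + 3).choose (m + 1) = (2 * m + 2).choose m + (2 * m + 2).choose (m + 1) := Nat.choose_succ_succ' _ _
  have pa2 : (2 * m + 3).choose (m + 2) = (2 * m + 2).choose (m + 1) + (2 * m + 2).choose (m + 2) := Nat.choose_succ_succ' _ _
  have pa3 : (2 * m + 4).choose (m + 2) = (2 * m + 3).choose (m + 1) + (2 * m + 3).choose (m + 2) := Nat.choose_succ_succ' _ _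
  have sy : (2 * m + 2).choose (m + 2) = (2 * m + 2).choose m := Nat.choose_symm_of_eq_add (by ring)
  have hab : (2 * m + 2).choose (m + 1) * (m + 1) = (2 * m + 2).choose m * (m + 2) := by
    have := Nat.choose_succ_right_eq (2 * m + 2) m
    rwa [show 2 * m + 2 - m = m + 2 by omega] at this
  have hmid' := congrArg (fun x : ℕ => (x : ℤ)) hmid
  push_cast at hmid'
  rw [hsplit, hrefl, Finset.sum_congr rfl hL, Finset.sum_congr rfl hU]
  simp only [Finset.sum_sub_distrib, Finset.sum_add_distrib, ← Finset.mul_sum]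
  rw [hA, hB, hA', hB', Nat.choose_self, Nat.choose_self]
  rw [show m + 2 + (m + 2) - 2 = 2 * m + 2 by omega, show m + 2 - 1 = m + 1 by omega]
  rw [show m + 2 + (m + 2) = 2 * m + 4 by ring] at *
  have habZ : (((2 * m + 2).choose (m + 1) : ℕ) : ℤ) * ((m : ℤ) + 1) = (((2 * m + 2).choose m : ℕ) : ℤ) * ((m : ℤ) + 2) := by
    exact_mod_cast hab
  have p1Z : (((2 * m + 3).choose (m + 1) : ℕ) : ℤ) = ((2 * m + 2).choose m : ℤ) + ((2 * m + 2).choose (m + 1) : ℤ) := by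
    exact_mod_cast pa1
  have p3Z : (((2 * m + 4).choose (m + 2) : ℕ) : ℤ) =
      2 * (((2 * m + 2).choose m : ℤ) + ((2 * m + 2).choose (m + 1) : ℤ)) := by
    rw [pa3, pa2, sy, pa1]; push_cast; ring
  have hR : (R (m + 2) : ℤ) = (m + 2 + 3) * ((2 * m + 4).choose (m + 2) : ℤ) - 2 * (m + 2 + 1) - δ := by linarith
  rw [hR, p3Z, p1Z]
  rw [pow_succ, pow_succ]
  push_cast
  linear_combination (2 * (-1 : ℤ) ^ m) * habZ
end Combinatorics

/-! ### 2. On the real carrier -/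

section RealCarrier

variable {A : AbelianVariety ℂ}

/-- **generic Euler-pin value, every `n ≥ 2`:** off the pins, `Σ_{k ≤ 2n} (−1)^k dim S_k(x) = (−1)ⁿ (2C(2n−2,n−1) + 2n + 2)` for the
`ch(O_Z)`-shapes (`q_m = 0` for `m < n`, `q_n ≠ 0`, any tail). [cite: BuchweitzFlenner2008HH, Prop. 6.4.4]
[cite: vanGeemen1994HodgeAV, 4.9 and Lemma 5.2] -/
theorem eulerSum_leading_generic (hA : IsSmoothProjective A.dim A.X) {n d : ℕ} (hdim : A.dim = n + n) (hd : 0 < d)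
    {φ : A ⟶ A} (hφ : φ ≫ φ = -(d • 𝟙 A)) {P Q : Submodule ℂ (complexBetti A.X 1)}
    (hP : P = Module.End.eigenspace (complexBetti.map φ.hom.hom.hom 1).hom (Complex.I * (Real.sqrt d : ℂ)))
    (hQ : Q = Module.End.eigenspace (complexBetti.map φ.hom.hom.hom 1).hom (-(Complex.I * (Real.sqrt d : ℂ))))
    (hp : finrank ℂ ↥(P ⊓ hodgeOneZero hA) = n) {h : complexBetti A.X 2}
    (hh : complexBetti.map φ.hom.hom.hom 2 h = (d : ℂ) • h) (h11 : IsOfHodgeType A.dim A.X 2 1 1 h)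
    (hvol : ((⋀[ℂ]^2 (complexBetti A.X 1)).subtype ((abelianVarietyCohomologyExteriorH1_holds.equiv A 2).symm h)) ^ (n + n) ≠ 0)
    {cP cQ : complexBetti A.X (2 * n)} (hcP : cP ∈ weilClassesPlus A φ n d) (hcP0 : cP ≠ 0)
    (hcQ : cQ ∈ weilClassesMinus A φ n d) (hcQ0 : cQ ≠ 0) (hn : 2 ≤ n)
    {q : ℕ → ℂ} (hq0 : ∀ m, m < n → q m = 0) (hqn : q n ≠ 0) {t : ℂ}
    (ht : (((n + n).factorial : ℕ) : ℂ) •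
        ((⋀[ℂ]^(2 * n) (complexBetti A.X 1)).subtype ((abelianVarietyCohomologyExteriorH1_holds.equiv A (2 * n)).symm cP) *
          (⋀[ℂ]^(2 * n) (complexBetti A.X 1)).subtype ((abelianVarietyCohomologyExteriorH1_holds.equiv A (2 * n)).symm cQ)) =
      t • ((⋀[ℂ]^2 (complexBetti A.X 1)).subtype ((abelianVarietyCohomologyExteriorH1_holds.equiv A 2).symm h)) ^ (n + n))
    (hgen : ∀ a, a ≤ n → t ≠ (-1 : ℂ) ^ n * ((n.choose a : ℂ) * (n.choose a : ℂ)) * (q n * q n)) :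
    (∑ k ∈ Finset.range (n + n + 1), (-1 : ℤ) ^ k * (finrank ℂ ↥(S ℂ (hodgeZeroOne hA) k
        ((∑ m ∈ Finset.range (n + n + 1), (q m * ((m.factorial : ℕ) : ℂ)⁻¹) •
            ((⋀[ℂ]^2 (complexBetti A.X 1)).subtype ((abelianVarietyCohomologyExteriorH1_holds.equiv A 2).symm h)) ^ m) +
          (⋀[ℂ]^(2 * n) (complexBetti A.X 1)).subtype ((abelianVarietyCohomologyExteriorH1_holds.equiv A (2 * n)).symm cP) +
          (⋀[ℂ]^(2 * n) (complexBetti A.X 1)).subtype ((abelianVarietyCohomologyExteriorH1_holds.equiv A (2 * n)).symm cQ))) : ℤ)) =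
      (-1 : ℤ) ^ n * (2 * ((n + n - 2).choose (n - 1) : ℤ) + 2 * n + 2) := by
  haveI : Module.Finite ℂ (complexBetti A.X 1) := abelianVarietyCohomologyExteriorH1_holds.finite_one A
  have hq0' : ∀ m, 1 ≤ m → m < n → q m = 0 := fun m _ hm => hq0 m hm
  rw [show (2 * ((n + n - 2).choose (n - 1) : ℤ) + 2 * n + 2) = 2 * ((n + n - 2).choose (n - 1) : ℤ) + 2 * n + 2 - ((0 : ℕ) : ℤ)
    by push_cast; ring]
  have hn1 : 1 ≤ n := by omega
  have h0 := finrank_S_weilType_zero hA hdim hd hφ hP hQ hp hh h11 hvol hcP hcP0 hcQ hcQ0 hn1 q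
  have htop := finrank_S_weilType_top hA hdim hd hφ hP hQ hp hh h11 hvol hcP hcP0 hcQ hcQ0 hn1 q
  refine alternating_sum_leading_row hn _ _ ?_ ?_ ?_
  · intro k hk
    rcases Nat.eq_zero_or_pos k with rfl | hk1
    · rw [h0, Nat.choose_zero_right, Nat.choose_zero_right]
    · exact finrank_S_leading_deg hA hdim hd hφ hP hQ hp hh h11 hvol hcP hcP0 hcQ hcQ0 hq0' hqn hk1 hk
  · intro k hk
    rcases Nat.eq_zero_or_pos k with rfl | hk1
    · rw [Nat.sub_zero, htop, Nat.choose_zero_right, Nat.choose_zero_right]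
    · exact finrank_S_leading_deg_dual hA hdim hd hφ hP hQ hp hh h11 hvol hcP hcP0 hcQ hcQ0 hq0' hqn (k := n + n - k)
        (k' := k) hk1 hk (by omega)
  · have h := finrank_S_leading_middle_generic hA hdim hd hφ hP hQ hp hh h11 hvol hcP hcP0 hcQ hcQ0 (by omega) hq0 hqn ht hgen
    omega

/-- **Euler-pin value at the self-dual pin, `n ≥ 2` even, `2a = n`, `t = (−1)ⁿ C(n,a)² q_n²`:**
`Σ_{k ≤ 2n} (−1)^k dim S_k(x) = (−1)ⁿ (2C(2n−2,n−1) + 2n + 1)` (any tail). [cite: BuchweitzFlenner2008HH, Prop. 6.4.4]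
[cite: vanGeemen1994HodgeAV, 4.9 and Lemma 5.2] -/
theorem eulerSum_leading_self_dual_pin (hA : IsSmoothProjective A.dim A.X) {n d : ℕ} (hdim : A.dim = n + n) (hd : 0 < d)
    {φ : A ⟶ A} (hφ : φ ≫ φ = -(d • 𝟙 A)) {P Q : Submodule ℂ (complexBetti A.X 1)}
    (hP : P = Module.End.eigenspace (complexBetti.map φ.hom.hom.hom 1).hom (Complex.I * (Real.sqrt d : ℂ)))
    (hQ : Q = Module.End.eigenspace (complexBetti.map φ.hom.hom.hom 1).hom (-(Complex.I * (Real.sqrt d : ℂ))))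
    (hp : finrank ℂ ↥(P ⊓ hodgeOneZero hA) = n) {h : complexBetti A.X 2}
    (hh : complexBetti.map φ.hom.hom.hom 2 h = (d : ℂ) • h) (h11 : IsOfHodgeType A.dim A.X 2 1 1 h)
    (hvol : ((⋀[ℂ]^2 (complexBetti A.X 1)).subtype ((abelianVarietyCohomologyExteriorH1_holds.equiv A 2).symm h)) ^ (n + n) ≠ 0)
    {cP cQ : complexBetti A.X (2 * n)} (hcP : cP ∈ weilClassesPlus A φ n d) (hcP0 : cP ≠ 0)
    (hcQ : cQ ∈ weilClassesMinus A φ n d) (hcQ0 : cQ ≠ 0) (hn : 2 ≤ n)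
    {q : ℕ → ℂ} (hq0 : ∀ m, m < n → q m = 0) (hqn : q n ≠ 0) {t : ℂ}
    (ht : (((n + n).factorial : ℕ) : ℂ) •
        ((⋀[ℂ]^(2 * n) (complexBetti A.X 1)).subtype ((abelianVarietyCohomologyExteriorH1_holds.equiv A (2 * n)).symm cP) *
          (⋀[ℂ]^(2 * n) (complexBetti A.X 1)).subtype ((abelianVarietyCohomologyExteriorH1_holds.equiv A (2 * n)).symm cQ)) =
      t • ((⋀[ℂ]^2 (complexBetti A.X 1)).subtype ((abelianVarietyCohomologyExteriorH1_holds.equiv A 2).symm h)) ^ (n + n))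
    {a : ℕ} (ha : 2 * a = n) (hpin : t = (-1 : ℂ) ^ n * ((n.choose a : ℂ) * (n.choose a : ℂ)) * (q n * q n)) :
    (∑ k ∈ Finset.range (n + n + 1), (-1 : ℤ) ^ k * (finrank ℂ ↥(S ℂ (hodgeZeroOne hA) k
        ((∑ m ∈ Finset.range (n + n + 1), (q m * ((m.factorial : ℕ) : ℂ)⁻¹) •
            ((⋀[ℂ]^2 (complexBetti A.X 1)).subtype ((abelianVarietyCohomologyExteriorH1_holds.equiv A 2).symm h)) ^ m) +
          (⋀[ℂ]^(2 * n) (complexBetti A.X 1)).subtype ((abelianVarietyCohomologyExteriorH1_holds.equiv A (2 * n)).symm cP) +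
          (⋀[ℂ]^(2 * n) (complexBetti A.X 1)).subtype ((abelianVarietyCohomologyExteriorH1_holds.equiv A (2 * n)).symm cQ))) : ℤ)) =
      (-1 : ℤ) ^ n * (2 * ((n + n - 2).choose (n - 1) : ℤ) + 2 * n + 1) := by
  haveI : Module.Finite ℂ (complexBetti A.X 1) := abelianVarietyCohomologyExteriorH1_holds.finite_one A
  have hq0' : ∀ m, 1 ≤ m → m < n → q m = 0 := fun m _ hm => hq0 m hm
  rw [show (2 * ((n + n - 2).choose (n - 1) : ℤ) + 2 * n + 1) = 2 * ((n + n - 2).choose (n - 1) : ℤ) + 2 * n + 2 - ((1 : ℕ) : ℤ)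
    by push_cast; ring]
  have hn1 : 1 ≤ n := by omega
  have h0 := finrank_S_weilType_zero hA hdim hd hφ hP hQ hp hh h11 hvol hcP hcP0 hcQ hcQ0 hn1 q
  have htop := finrank_S_weilType_top hA hdim hd hφ hP hQ hp hh h11 hvol hcP hcP0 hcQ hcQ0 hn1 q
  refine alternating_sum_leading_row hn _ _ ?_ ?_ ?_
  · intro k hk
    rcases Nat.eq_zero_or_pos k with rfl | hk1
    · rw [h0, Nat.choose_zero_right, Nat.choose_zero_right]
    · exact finrank_S_leading_deg hA hdim hd hφ hP hQ hp hh h11 hvol hcP hcP0 hcQ hcQ0 hq0' hqn hk1 hk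
  · intro k hk
    rcases Nat.eq_zero_or_pos k with rfl | hk1
    · rw [Nat.sub_zero, htop, Nat.choose_zero_right, Nat.choose_zero_right]
    · exact finrank_S_leading_deg_dual hA hdim hd hφ hP hQ hp hh h11 hvol hcP hcP0 hcQ hcQ0 hq0' hqn (k := n + n - k)
        (k' := k) hk1 hk (by omega)
  · exact finrank_S_leading_middle_self_dual_pin hA hdim hd hφ hP hQ hp hh h11 hvol hcP hcP0 hcQ hcQ0 (by omega) hq0 hqn ht
      ha hpin

/-- **Euler-pin value at a pin, `n ≥ 3` odd, `a ≤ n`, `t = (−1)ⁿ C(n,a)² q_n²:** `Σ_{k ≤ 2n} (−1)^k dim S_k(x) = (−1)ⁿ (2C(2n−2,n−1) + 2n)`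
(any tail; `n = 3`: `−18`). [cite: BuchweitzFlenner2008HH, Prop. 6.4.4] [cite: vanGeemen1994HodgeAV, 4.9 and Lemma 5.2] -/
theorem eulerSum_leading_pin_odd (hA : IsSmoothProjective A.dim A.X) {n d : ℕ} (hdim : A.dim = n + n) (hd : 0 < d)
    {φ : A ⟶ A} (hφ : φ ≫ φ = -(d • 𝟙 A)) {P Q : Submodule ℂ (complexBetti A.X 1)}
    (hP : P = Module.End.eigenspace (complexBetti.map φ.hom.hom.hom 1).hom (Complex.I * (Real.sqrt d : ℂ)))
    (hQ : Q = Module.End.eigenspace (complexBetti.map φ.hom.hom.hom 1).hom (-(Complex.I * (Real.sqrt d : ℂ))))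
    (hp : finrank ℂ ↥(P ⊓ hodgeOneZero hA) = n) {h : complexBetti A.X 2}
    (hh : complexBetti.map φ.hom.hom.hom 2 h = (d : ℂ) • h) (h11 : IsOfHodgeType A.dim A.X 2 1 1 h)
    (hvol : ((⋀[ℂ]^2 (complexBetti A.X 1)).subtype ((abelianVarietyCohomologyExteriorH1_holds.equiv A 2).symm h)) ^ (n + n) ≠ 0)
    {cP cQ : complexBetti A.X (2 * n)} (hcP : cP ∈ weilClassesPlus A φ n d) (hcP0 : cP ≠ 0)
    (hcQ : cQ ∈ weilClassesMinus A φ n d) (hcQ0 : cQ ≠ 0) (hn : 2 ≤ n)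
    {q : ℕ → ℂ} (hq0 : ∀ m, m < n → q m = 0) (hqn : q n ≠ 0) {t : ℂ}
    (ht : (((n + n).factorial : ℕ) : ℂ) •
        ((⋀[ℂ]^(2 * n) (complexBetti A.X 1)).subtype ((abelianVarietyCohomologyExteriorH1_holds.equiv A (2 * n)).symm cP) *
          (⋀[ℂ]^(2 * n) (complexBetti A.X 1)).subtype ((abelianVarietyCohomologyExteriorH1_holds.equiv A (2 * n)).symm cQ)) =
      t • ((⋀[ℂ]^2 (complexBetti A.X 1)).subtype ((abelianVarietyCohomologyExteriorH1_holds.equiv A 2).symm h)) ^ (n + n))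
    (hodd : Odd n) {a : ℕ} (ha : a ≤ n) (hpin : t = (-1 : ℂ) ^ n * ((n.choose a : ℂ) * (n.choose a : ℂ)) * (q n * q n)) :
    (∑ k ∈ Finset.range (n + n + 1), (-1 : ℤ) ^ k * (finrank ℂ ↥(S ℂ (hodgeZeroOne hA) k
        ((∑ m ∈ Finset.range (n + n + 1), (q m * ((m.factorial : ℕ) : ℂ)⁻¹) •
            ((⋀[ℂ]^2 (complexBetti A.X 1)).subtype ((abelianVarietyCohomologyExteriorH1_holds.equiv A 2).symm h)) ^ m) +
          (⋀[ℂ]^(2 * n) (complexBetti A.X 1)).subtype ((abelianVarietyCohomologyExteriorH1_holds.equiv A (2 * n)).symm cP) +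
          (⋀[ℂ]^(2 * n) (complexBetti A.X 1)).subtype ((abelianVarietyCohomologyExteriorH1_holds.equiv A (2 * n)).symm cQ))) : ℤ)) =
      (-1 : ℤ) ^ n * (2 * ((n + n - 2).choose (n - 1) : ℤ) + 2 * n) := by
  haveI : Module.Finite ℂ (complexBetti A.X 1) := abelianVarietyCohomologyExteriorH1_holds.finite_one A
  have hq0' : ∀ m, 1 ≤ m → m < n → q m = 0 := fun m _ hm => hq0 m hm
  rw [show (2 * ((n + n - 2).choose (n - 1) : ℤ) + 2 * n) = 2 * ((n + n - 2).choose (n - 1) : ℤ) + 2 * n + 2 - ((2 : ℕ) : ℤ)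
    by push_cast; ring]
  have hn1 : 1 ≤ n := by omega
  have h0 := finrank_S_weilType_zero hA hdim hd hφ hP hQ hp hh h11 hvol hcP hcP0 hcQ hcQ0 hn1 q
  have htop := finrank_S_weilType_top hA hdim hd hφ hP hQ hp hh h11 hvol hcP hcP0 hcQ hcQ0 hn1 q
  refine alternating_sum_leading_row hn _ _ ?_ ?_ ?_
  · intro k hk
    rcases Nat.eq_zero_or_pos k with rfl | hk1
    · rw [h0, Nat.choose_zero_right, Nat.choose_zero_right]
    · exact finrank_S_leading_deg hA hdim hd hφ hP hQ hp hh h11 hvol hcP hcP0 hcQ hcQ0 hq0' hqn hk1 hk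
  · intro k hk
    rcases Nat.eq_zero_or_pos k with rfl | hk1
    · rw [Nat.sub_zero, htop, Nat.choose_zero_right, Nat.choose_zero_right]
    · exact finrank_S_leading_deg_dual hA hdim hd hφ hP hQ hp hh h11 hvol hcP hcP0 hcQ hcQ0 hq0' hqn (k := n + n - k)
        (k' := k) hk1 hk (by omega)
  · exact finrank_S_leading_middle_pin_odd hA hdim hd hφ hP hQ hp hh h11 hvol hcP hcP0 hcQ hcQ0 (by omega) hq0 hqn ht
      hodd ha hpin

/-- **Euler-pin value of the PURE middle row at a pin, every `n ≥ 2`** (`q_m = 0` for `m ≠ n`, `q_n ≠ 0`, `a ≤ n`,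
`t = (−1)ⁿ C(n,a)² q_n²`): `Σ_{k ≤ 2n} (−1)^k dim S_k(x) = (−1)ⁿ (2C(2n−2,n−1) + 2n + 2 − (1 if 2a = n else 2))`.
[cite: BuchweitzFlenner2008HH, Prop. 6.4.4] [cite: vanGeemen1994HodgeAV, 4.9 and Lemma 5.2] -/
theorem eulerSum_pureMiddle_pin (hA : IsSmoothProjective A.dim A.X) {n d : ℕ} (hdim : A.dim = n + n) (hd : 0 < d)
    {φ : A ⟶ A} (hφ : φ ≫ φ = -(d • 𝟙 A)) {P Q : Submodule ℂ (complexBetti A.X 1)}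
    (hP : P = Module.End.eigenspace (complexBetti.map φ.hom.hom.hom 1).hom (Complex.I * (Real.sqrt d : ℂ)))
    (hQ : Q = Module.End.eigenspace (complexBetti.map φ.hom.hom.hom 1).hom (-(Complex.I * (Real.sqrt d : ℂ))))
    (hp : finrank ℂ ↥(P ⊓ hodgeOneZero hA) = n) {h : complexBetti A.X 2}
    (hh : complexBetti.map φ.hom.hom.hom 2 h = (d : ℂ) • h) (h11 : IsOfHodgeType A.dim A.X 2 1 1 h)
    (hvol : ((⋀[ℂ]^2 (complexBetti A.X 1)).subtype ((abelianVarietyCohomologyExteriorH1_holds.equiv A 2).symm h)) ^ (n + n) ≠ 0)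
    {cP cQ : complexBetti A.X (2 * n)} (hcP : cP ∈ weilClassesPlus A φ n d) (hcP0 : cP ≠ 0)
    (hcQ : cQ ∈ weilClassesMinus A φ n d) (hcQ0 : cQ ≠ 0) (hn : 2 ≤ n)
    {q : ℕ → ℂ} (hq : ∀ m, m ≠ n → q m = 0) (hqn : q n ≠ 0) {t : ℂ}
    (ht : (((n + n).factorial : ℕ) : ℂ) •
        ((⋀[ℂ]^(2 * n) (complexBetti A.X 1)).subtype ((abelianVarietyCohomologyExteriorH1_holds.equiv A (2 * n)).symm cP) *
          (⋀[ℂ]^(2 * n) (complexBetti A.X 1)).subtype ((abelianVarietyCohomologyExteriorH1_holds.equiv A (2 * n)).symm cQ)) =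
      t • ((⋀[ℂ]^2 (complexBetti A.X 1)).subtype ((abelianVarietyCohomologyExteriorH1_holds.equiv A 2).symm h)) ^ (n + n))
    {a : ℕ} (ha : a ≤ n) (hpin : t = (-1 : ℂ) ^ n * ((n.choose a : ℂ) * (n.choose a : ℂ)) * (q n * q n)) :
    (∑ k ∈ Finset.range (n + n + 1), (-1 : ℤ) ^ k * (finrank ℂ ↥(S ℂ (hodgeZeroOne hA) k
        ((∑ m ∈ Finset.range (n + n + 1), (q m * ((m.factorial : ℕ) : ℂ)⁻¹) •
            ((⋀[ℂ]^2 (complexBetti A.X 1)).subtype ((abelianVarietyCohomologyExteriorH1_holds.equiv A 2).symm h)) ^ m) +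
          (⋀[ℂ]^(2 * n) (complexBetti A.X 1)).subtype ((abelianVarietyCohomologyExteriorH1_holds.equiv A (2 * n)).symm cP) +
          (⋀[ℂ]^(2 * n) (complexBetti A.X 1)).subtype ((abelianVarietyCohomologyExteriorH1_holds.equiv A (2 * n)).symm cQ))) : ℤ)) =
      (-1 : ℤ) ^ n * (2 * ((n + n - 2).choose (n - 1) : ℤ) + 2 * n + 2 - ((if 2 * a = n then 1 else 2 : ℕ) : ℤ)) := by
  haveI : Module.Finite ℂ (complexBetti A.X 1) := abelianVarietyCohomologyExteriorH1_holds.finite_one A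
  have hq0' : ∀ m, 1 ≤ m → m < n → q m = 0 := fun m _ hm => hq m (by omega)
  have hn1 : 1 ≤ n := by omega
  have h0 := finrank_S_weilType_zero hA hdim hd hφ hP hQ hp hh h11 hvol hcP hcP0 hcQ hcQ0 hn1 q
  have htop := finrank_S_weilType_top hA hdim hd hφ hP hQ hp hh h11 hvol hcP hcP0 hcQ hcQ0 hn1 q
  refine alternating_sum_leading_row hn _ _ ?_ ?_ ?_
  · intro k hk
    rcases Nat.eq_zero_or_pos k with rfl | hk1
    · rw [h0, Nat.choose_zero_right, Nat.choose_zero_right]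
    · exact finrank_S_leading_deg hA hdim hd hφ hP hQ hp hh h11 hvol hcP hcP0 hcQ hcQ0 hq0' hqn hk1 hk
  · intro k hk
    rcases Nat.eq_zero_or_pos k with rfl | hk1
    · rw [Nat.sub_zero, htop, Nat.choose_zero_right, Nat.choose_zero_right]
    · exact finrank_S_leading_deg_dual hA hdim hd hφ hP hQ hp hh h11 hvol hcP hcP0 hcQ hcQ0 hq0' hqn (k := n + n - k)
        (k' := k) hk1 hk (by omega)
  · exact finrank_S_pureMiddle_pin hA hdim hd hφ hP hQ hp hh h11 hvol hcP hcP0 hcQ hcQ0 (by omega) hq hqn ht ha hpin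

end RealCarrier

end Summit.Ventures.HSemireg.WeilFrame

end
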